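import Summits.AtomisticToContinuum.Crystallization.Theorems.FrustratedLawDichotomyStrainedPatchHomLatticeBoxHcp

/-!
# The certifier's PRUNES as named transfer lemmas: «this deformation is realised by NO admissible ball»
# (27623 strained-patch piece, `(H) HomFloor`; decomp-a2c, prover hand 2, generation 20; critic row 758: «prunes only through
# `homFloor_iff_latticeSums`, each prune a named lemma»)

`homFloor_iff_latticeSums` (p842566) conditions each lattice-sum inequality on REALISABILITY: `∃ M z c, Admissible M z c ∧ range z = Λ-ball`.
CERT-DESIGN-g44 §2 closes most leaves not by the inequality but by a PRUNE — a certified property of the deformed lattice that contradicts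
`Admissible` for every cluster enumerating its ball: (P1) the centre is `1/20`-GOOD at fit scale `≤ 3/2` (⟹ `TightNearCap`), (P2) the centre is
`1/8`-BAD (⟹ `BadNearCap`), (P3) a ONE-ATOM MOVE of the centre gains more than the move slack (⟹ `MoveUnstableCore 0 7 s` ⟹ `ExRec` ⟹ `ExemptNear`),
(P3′) REMOVING the centre gains (⟹ `RemovalUnstableCore`).  This DEF-FREE module proves the transfers:

* §1 the clauses at the CENTRE kill admissibility (`not_admissible_of_centre_good/_bad/_moveUnstable/_removalUnstable`);
* §2 `GoodAtScale η D y i` depends on the cluster only through `(Set.range y, y i)` (`goodAtScale_iff_of_range_eq`) — any enumeration will do;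
* §3 ★ the move / removal tests at the centre IN LATTICE-SUM FORM: if the ball is locally homogeneous at the centre with displacement set `T`
  (radius `15/2 > R_m = 7`), then `MoveUnstableCore 0 7 s` at the centre follows from ONE displacement `q` (`‖q‖ ≤ s`, `‖q‖ < 7/10`) with
  `∑ᶠ_{v ∈ T, 0 < ‖v‖ ≤ 7} V_LJ ‖q − v‖ + s·(7/(7−s))⁷·S₇♯(7) < ∑ᶠ_{v ∈ T, 0 < ‖v‖ ≤ 7} V_LJ ‖v‖` (`moveUnstableCore_centre_of_latticeSums`), and
  `RemovalUnstableCore e t 7` from `e + t + T♯(7) < ∑ᶠ_{v ∈ T, 0 < ‖v‖ ≤ 7} V_LJ ‖v‖` (`removalUnstableCore_centre_of_latticeSum`);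
* §4 ★★ the prunes in the shape of `homFloor_iff_latticeSums`' realisability hypotheses, fcc (`T = G·L_fcc`) and hcp (`T_A`):
  `not_realised_fcc_of_forceOut`, `not_realised_hcp_of_forceOut` (and the good/bad forms).

0 sorry; no definitions; axioms ⊆ {propext, Classical.choice, Quot.sound}.  `--supports stmt-AtomisticToContinuum-27623`.
-/

noncomputable section

namespace Summit.AtomisticToContinuum.Crystallization.Theorems.FrustratedLawDichotomyStrainedPatchHomPrunes

open scoped BigOperators Classical
open Literature.MathematicalPhysics.StatisticalMechanics (lennardJones)
open Summit.AtomisticToContinuum.Crystallization.Theorems.ChargedEnergyGapNegative (E3)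
open Summit.AtomisticToContinuum.Crystallization.Theorems.FrustratedLawDichotomyMotifLemmas (GoodAtScale)
open Summit.AtomisticToContinuum.Crystallization.Theorems.FrustratedLawDichotomyAveragingCut (ball ballAvg mem_ball self_mem_ball)
open Summit.AtomisticToContinuum.Crystallization.Theorems.FrustratedLawDichotomyAveragingRuleTightFree (TightNearCap BadNearCap)
open Summit.AtomisticToContinuum.Crystallization.Theorems.FrustratedLawDichotomyExemptAbsorption (ExemptNear)
open Summit.AtomisticToContinuum.Crystallization.Theorems.FrustratedLawDichotomyExemptAbsorptionRecord
  (MoveUnstableCore RemovalUnstableCore NonEquilibriumCore)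
open Summit.AtomisticToContinuum.Crystallization.Theorems.FrustratedLawDichotomyExemptLocalSharp (tailConstSharp)
open Summit.AtomisticToContinuum.Crystallization.Theorems.FrustratedLawDichotomyCollarCensus (Collar)
open Summit.AtomisticToContinuum.Crystallization.Theorems.FrustratedLawDichotomyStrainedPatchHomSplit
open Summit.AtomisticToContinuum.Crystallization.Theorems.FrustratedLawDichotomyStrainedPatchHomLattice
open Summit.AtomisticToContinuum.Crystallization.Theorems.FrustratedLawDichotomyStrainedPatchHomLatticeBox (latPt_zero)
open Literature.Barriers.AtomisticToContinuum.FlatleyTheil2015 (fccVec)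

/-! ## §1. The centre clauses kill admissibility -/

/-- (P1) A `1/20`-good centre (fit scale `≤ 3/2`) makes the `9/5`-ball capped-tight: not admissible. [folklore] -/
theorem not_admissible_of_centre_good {M : ℕ} {z : Fin M → E3} {c : Fin M} (h : GoodAtScale (1 / 20) (3 / 2) z c) : ¬Admissible M z c :=
  fun hA => hA.2.2.2.1 ⟨c, self_mem_ball (by norm_num) z c, h⟩

/-- (P2) A `1/8`-bad centre makes the `9/5`-ball bad: not admissible. [folklore] -/
theorem not_admissible_of_centre_bad {M : ℕ} {z : Fin M → E3} {c : Fin M} (h : ¬GoodAtScale (1 / 8) (3 / 2) z c) : ¬Admissible M z c :=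
  fun hA => hA.2.2.2.2.2 ⟨c, self_mem_ball (by norm_num) z c, h⟩

/-- (P3) A one-atom-move-unstable centre (`MoveUnstableCore 0 7 s`, `0 ≤ s ≤ 3/2`) is `ExRec`-exempt: not admissible. [folklore] -/
theorem not_admissible_of_centre_moveUnstable {M : ℕ} {z : Fin M → E3} {c : Fin M} {s : ℝ} (hs0 : 0 ≤ s) (hs1 : s ≤ 3 / 2)
    (h : MoveUnstableCore 0 7 s M z c) : ¬Admissible M z c := fun hA =>
  hA.2.2.2.2.1 ⟨c, self_mem_ball (by norm_num) z c, by
    unfold ExRec Collar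
    exact ⟨c, self_mem_ball (by norm_num) z c, Or.inl ⟨s, hs0, hs1, Or.inl h⟩⟩⟩

/-- (P3′) A removal-unstable centre (`RemovalUnstableCore (−0.7175) 10⁻⁴ 7`) is `ExRec`-exempt: not admissible. [folklore] -/
theorem not_admissible_of_centre_removalUnstable {M : ℕ} {z : Fin M → E3} {c : Fin M}
    (h : RemovalUnstableCore (-(7175 / 10000)) (1 / 10000) 7 M z c) : ¬Admissible M z c := fun hA =>
  hA.2.2.2.2.1 ⟨c, self_mem_ball (by norm_num) z c, by
    unfold ExRec Collar
    exact ⟨c, self_mem_ball (by norm_num) z c, Or.inl ⟨0, le_rfl, by norm_num, Or.inr h⟩⟩⟩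

/-! ## §2. The two-shell fit predicate depends only on the point set and the point -/

/-- ★ `GoodAtScale η D y i` depends on the cluster only through `(Set.range y, y i)`: any enumeration of the same point set, at the same point,
is good iff the original is. [folklore] -/
theorem goodAtScale_iff_of_range_eq {η D : ℝ} {N N' : ℕ} {y : Fin N → E3} {y' : Fin N' → E3} {i : Fin N} {i' : Fin N'}
    (hr : Set.range y = Set.range y') (hp : y i = y' i') : GoodAtScale η D y i ↔ GoodAtScale η D y' i' := by
  unfold GoodAtScale
  rw [hr, hp]

/-! ## §3. The move / removal tests at the centre in lattice-sum form -/

/-- The localised site sum of the centre as a site sum of a kernel vanishing beyond `R_m = 7` (injective cluster). [folklore] -/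
theorem localSum_centre_eq_sum {M : ℕ} {z : Fin M → E3} (hz : Function.Injective z) (c : Fin M) (F : E3 → ℝ) :
    ∑ k ∈ (Finset.univ.erase c).filter (fun k => dist (z k) (z c) ≤ 7), F (z k - z c) =
      ∑ k : Fin M, (if z k - z c ≠ 0 ∧ ‖z k - z c‖ ≤ 7 then F (z k - z c) else 0) := by
  rw [Finset.sum_filter, ← Finset.sum_erase_add _ _ (Finset.mem_univ c)]
  simp only [sub_self, ne_eq, not_true_eq_false, false_and, if_false, add_zero]
  refine Finset.sum_congr rfl fun k hk => ?_
  have hkc : k ≠ c := (Finset.mem_erase.1 hk).1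
  have hne : z k - z c ≠ 0 := fun h => hkc (hz (sub_eq_zero.1 h))
  simp [dist_eq_norm, hne]

/-- The same sum through a displacement set `T` (local homogeneity at the centre within `15/2`). [folklore] -/
theorem localSum_centre_eq_finsum {M : ℕ} {z : Fin M → E3} (hz : Function.Injective z) {c : Fin M} {T : Set E3}
    (hT : ∀ x : E3, dist x (z c) < 15 / 2 → (x ∈ Set.range z ↔ x - z c ∈ T)) (F : E3 → ℝ) :
    ∑ k ∈ (Finset.univ.erase c).filter (fun k => dist (z k) (z c) ≤ 7), F (z k - z c) =
      ∑ᶠ v ∈ {v : E3 | v ≠ 0 ∧ ‖v‖ ≤ 7 ∧ v ∈ T}, F v := by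
  rw [localSum_centre_eq_sum hz c F,
    sum_eq_finsum_mem_of_locHom hz hT (fun v : E3 => if v ≠ 0 ∧ ‖v‖ ≤ 7 then F v else 0) fun v hv => by
      have : ¬‖v‖ ≤ 7 := fun h => by linarith
      simp [this]]
  rw [finsum_mem_def, finsum_mem_def]
  congr 1
  funext v
  by_cases hv0 : v = 0
  · simp [Set.indicator, hv0]
  · by_cases hv7 : ‖v‖ ≤ 7
    · by_cases hvT : v ∈ T <;> simp [Set.indicator, hv0, hv7, hvT]
    · simp [Set.indicator, hv0, hv7]

/-- ★ **(P3) in lattice-sum form.**  If the ball is locally homogeneous at the centre (displacement set `T` within `15/2`) and SOME displacement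
`q` with `‖q‖ ≤ s`, `‖q‖ < 7/10` satisfies
`∑ᶠ_{v ∈ T, 0 < ‖v‖ ≤ 7} V_LJ ‖q − v‖ + (0 + s·(7/(7−s))⁷·S₇♯(7)) < ∑ᶠ_{v ∈ T, 0 < ‖v‖ ≤ 7} V_LJ ‖v‖`, then `MoveUnstableCore 0 7 s` holds at the
centre. [folklore] -/
theorem moveUnstableCore_centre_of_latticeSums {M : ℕ} {z : Fin M → E3} (hz : Function.Injective z) {c : Fin M} {T : Set E3}
    (hT : ∀ x : E3, dist x (z c) < 15 / 2 → (x ∈ Set.range z ↔ x - z c ∈ T)) {s : ℝ} {q : E3} (hqs : ‖q‖ ≤ s) (hq7 : ‖q‖ < 7 / 10)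
    (hlt : (∑ᶠ v ∈ {v : E3 | v ≠ 0 ∧ ‖v‖ ≤ 7 ∧ v ∈ T}, lennardJones ‖q - v‖) +
        (0 + s * (7 / (7 - s)) ^ 7 * (6000 / 343 * (7 : ℝ)⁻¹ ^ 4 + 2880 / 49 * (7 : ℝ)⁻¹ ^ 5 + 10 / 7 * (7 : ℝ)⁻¹ ^ 6 + 2 * (7 : ℝ)⁻¹ ^ 7)) <
      ∑ᶠ v ∈ {v : E3 | v ≠ 0 ∧ ‖v‖ ≤ 7 ∧ v ∈ T}, lennardJones ‖v‖) :
    MoveUnstableCore 0 7 s M z c := by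
  have hL : ∑ k ∈ (Finset.univ.erase c).filter (fun k => dist (z k) (z c) ≤ 7), lennardJones (dist (z c + q) (z k)) =
      ∑ᶠ v ∈ {v : E3 | v ≠ 0 ∧ ‖v‖ ≤ 7 ∧ v ∈ T}, lennardJones ‖q - v‖ := by
    rw [← localSum_centre_eq_finsum hz hT (fun v => lennardJones ‖q - v‖)]
    refine Finset.sum_congr rfl fun k _ => ?_
    rw [dist_eq_norm]
    congr 2
    abel
  have hR : ∑ k ∈ (Finset.univ.erase c).filter (fun k => dist (z k) (z c) ≤ 7), lennardJones (dist (z c) (z k)) =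
      ∑ᶠ v ∈ {v : E3 | v ≠ 0 ∧ ‖v‖ ≤ 7 ∧ v ∈ T}, lennardJones ‖v‖ := by
    rw [← localSum_centre_eq_finsum hz hT (fun v => lennardJones ‖v‖)]
    refine Finset.sum_congr rfl fun k _ => ?_
    rw [dist_comm, dist_eq_norm]
  refine ⟨z c + q, ?_, ?_, ?_⟩
  · simpa [dist_eq_norm] using hqs
  · simpa [dist_eq_norm] using hq7
  · rw [hL, hR]
    exact hlt

/-- ★ **(P3′) in lattice-sum form**: `e + t + T♯(7) < ∑ᶠ_{v ∈ T, 0 < ‖v‖ ≤ 7} V_LJ ‖v‖ ⟹ RemovalUnstableCore e t 7` at the centre. [folklore] -/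
theorem removalUnstableCore_centre_of_latticeSum {M : ℕ} {z : Fin M → E3} (hz : Function.Injective z) {c : Fin M} {T : Set E3}
    (hT : ∀ x : E3, dist x (z c) < 15 / 2 → (x ∈ Set.range z ↔ x - z c ∈ T)) {e t : ℝ}
    (hlt : e + t + tailConstSharp 7 < ∑ᶠ v ∈ {v : E3 | v ≠ 0 ∧ ‖v‖ ≤ 7 ∧ v ∈ T}, lennardJones ‖v‖) :
    RemovalUnstableCore e t 7 M z c := by
  have hR : ∑ k ∈ (Finset.univ.erase c).filter (fun k => dist (z k) (z c) ≤ 7), lennardJones (dist (z c) (z k)) =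
      ∑ᶠ v ∈ {v : E3 | v ≠ 0 ∧ ‖v‖ ≤ 7 ∧ v ∈ T}, lennardJones ‖v‖ := by
    rw [← localSum_centre_eq_finsum hz hT (fun v => lennardJones ‖v‖)]
    refine Finset.sum_congr rfl fun k _ => ?_
    rw [dist_comm, dist_eq_norm]
  unfold RemovalUnstableCore
  rw [hR]
  exact hlt

/-! ## §4. The prunes in the shape of `homFloor_iff_latticeSums`' realisability hypotheses -/

/-- Local homogeneity AT THE CENTRE of an fcc ball, radius `15/2` (`≤ 133/10`). [folklore] -/
theorem locHom_fcc_centre {M : ℕ} {z : Fin M → E3} {c : Fin M} {G : E3 →L[ℝ] E3}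
    (hrange : Set.range z = {x : E3 | dist x (z c) ≤ 133 / 10 ∧ ∃ a : Fin 3 → ℤ, x = z c + latPt G fccVec a}) :
    ∀ x : E3, dist x (z c) < 15 / 2 → (x ∈ Set.range z ↔ x - z c ∈ {v : E3 | ∃ b : Fin 3 → ℤ, v = latPt G fccVec b}) := by
  intro x hx
  rw [hrange]
  constructor
  · rintro ⟨-, a, ha⟩
    exact ⟨a, by rw [ha]; abel⟩
  · rintro ⟨b, hb⟩
    exact ⟨by linarith, b, by rw [← sub_add_cancel x (z c), hb]; abel⟩

/-- Local homogeneity AT THE CENTRE of an hcp ball (A-representation of the centre), radius `15/2`. [folklore] -/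
theorem locHom_hcp_centre {M : ℕ} {z : Fin M → E3} {c : Fin M} {G : E3 →L[ℝ] E3} {ξ : E3}
    (hrange : Set.range z = {x : E3 | dist x (z c) ≤ 133 / 10 ∧ ∃ a : Fin 3 → ℤ,
      x = z c + latPt G hexFrame a ∨ x = z c + latPt G hexFrame a + G (hcpShift + ξ)}) :
    ∀ x : E3, dist x (z c) < 15 / 2 → (x ∈ Set.range z ↔
      x - z c ∈ {v : E3 | ∃ b : Fin 3 → ℤ, v = latPt G hexFrame b ∨ v = latPt G hexFrame b + G (hcpShift + ξ)}) := by
  intro x hx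
  rw [hrange]
  constructor
  · rintro ⟨-, a, ha | ha⟩
    · exact ⟨a, Or.inl (by rw [ha]; abel)⟩
    · exact ⟨a, Or.inr (by rw [ha]; abel)⟩
  · rintro ⟨b, hb | hb⟩
    · exact ⟨by linarith, b, Or.inl (by rw [← sub_add_cancel x (z c), hb]; abel)⟩
    · exact ⟨by linarith, b, Or.inr (by rw [← sub_add_cancel x (z c), hb]; abel)⟩

/-- ★★ **(P3) PRUNE, fcc: a certified one-atom move of the centre ⟹ the deformation `G` is realised by NO admissible fcc ball.**
Hypothesis = ONE displacement `q` and ONE lattice-sum inequality over `G·L_fcc ∩ {0 < ‖v‖ ≤ 7}`. [folklore] -/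
theorem not_realised_fcc_of_forceOut {G : E3 →L[ℝ] E3} {s : ℝ} (hs0 : 0 ≤ s) (hs1 : s ≤ 3 / 2) {q : E3} (hqs : ‖q‖ ≤ s)
    (hq7 : ‖q‖ < 7 / 10)
    (hlt : (∑ᶠ v ∈ {v : E3 | v ≠ 0 ∧ ‖v‖ ≤ 7 ∧ v ∈ {v : E3 | ∃ b : Fin 3 → ℤ, v = latPt G fccVec b}}, lennardJones ‖q - v‖) +
        (0 + s * (7 / (7 - s)) ^ 7 * (6000 / 343 * (7 : ℝ)⁻¹ ^ 4 + 2880 / 49 * (7 : ℝ)⁻¹ ^ 5 + 10 / 7 * (7 : ℝ)⁻¹ ^ 6 + 2 * (7 : ℝ)⁻¹ ^ 7)) <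
      ∑ᶠ v ∈ {v : E3 | v ≠ 0 ∧ ‖v‖ ≤ 7 ∧ v ∈ {v : E3 | ∃ b : Fin 3 → ℤ, v = latPt G fccVec b}}, lennardJones ‖v‖) :
    ¬∃ (M : ℕ) (z : Fin M → E3) (c : Fin M), Admissible M z c ∧
      Set.range z = {x : E3 | dist x (z c) ≤ 133 / 10 ∧ ∃ a : Fin 3 → ℤ, x = z c + latPt G fccVec a} := by
  rintro ⟨M, z, c, hA, hrange⟩
  exact not_admissible_of_centre_moveUnstable hs0 hs1
    (moveUnstableCore_centre_of_latticeSums hA.1 (locHom_fcc_centre hrange) hqs hq7 hlt) hA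

/-- ★★ **(P3) PRUNE, hcp**: the same with the displacement set `T_A = G·L_hex ∪ (G·L_hex + G(hcpShift + ξ))`. [folklore] -/
theorem not_realised_hcp_of_forceOut {G : E3 →L[ℝ] E3} {ξ : E3} {s : ℝ} (hs0 : 0 ≤ s) (hs1 : s ≤ 3 / 2) {q : E3} (hqs : ‖q‖ ≤ s)
    (hq7 : ‖q‖ < 7 / 10)
    (hlt : (∑ᶠ v ∈ {v : E3 | v ≠ 0 ∧ ‖v‖ ≤ 7 ∧
          v ∈ {v : E3 | ∃ b : Fin 3 → ℤ, v = latPt G hexFrame b ∨ v = latPt G hexFrame b + G (hcpShift + ξ)}}, lennardJones ‖q - v‖) +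
        (0 + s * (7 / (7 - s)) ^ 7 * (6000 / 343 * (7 : ℝ)⁻¹ ^ 4 + 2880 / 49 * (7 : ℝ)⁻¹ ^ 5 + 10 / 7 * (7 : ℝ)⁻¹ ^ 6 + 2 * (7 : ℝ)⁻¹ ^ 7)) <
      ∑ᶠ v ∈ {v : E3 | v ≠ 0 ∧ ‖v‖ ≤ 7 ∧
          v ∈ {v : E3 | ∃ b : Fin 3 → ℤ, v = latPt G hexFrame b ∨ v = latPt G hexFrame b + G (hcpShift + ξ)}}, lennardJones ‖v‖) :
    ¬∃ (M : ℕ) (z : Fin M → E3) (c : Fin M), Admissible M z c ∧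
      Set.range z = {x : E3 | dist x (z c) ≤ 133 / 10 ∧ ∃ a : Fin 3 → ℤ,
        x = z c + latPt G hexFrame a ∨ x = z c + latPt G hexFrame a + G (hcpShift + ξ)} := by
  rintro ⟨M, z, c, hA, hrange⟩
  exact not_admissible_of_centre_moveUnstable hs0 hs1
    (moveUnstableCore_centre_of_latticeSums hA.1 (locHom_hcp_centre hrange) hqs hq7 hlt) hA

/-- ★ **(P3′) PRUNE, fcc**: a removal-unstable centre (`−0.7175 + 10⁻⁴ + T♯(7) <` the local site sum) ⟹ not realised. [folklore] -/
theorem not_realised_fcc_of_removalOut {G : E3 →L[ℝ] E3}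
    (hlt : -(7175 / 10000) + 1 / 10000 + tailConstSharp 7 <
      ∑ᶠ v ∈ {v : E3 | v ≠ 0 ∧ ‖v‖ ≤ 7 ∧ v ∈ {v : E3 | ∃ b : Fin 3 → ℤ, v = latPt G fccVec b}}, lennardJones ‖v‖) :
    ¬∃ (M : ℕ) (z : Fin M → E3) (c : Fin M), Admissible M z c ∧
      Set.range z = {x : E3 | dist x (z c) ≤ 133 / 10 ∧ ∃ a : Fin 3 → ℤ, x = z c + latPt G fccVec a} := by
  rintro ⟨M, z, c, hA, hrange⟩
  exact not_admissible_of_centre_removalUnstable (removalUnstableCore_centre_of_latticeSum hA.1 (locHom_fcc_centre hrange) hlt) hA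

/-- ★ **(P3′) PRUNE, hcp.** [folklore] -/
theorem not_realised_hcp_of_removalOut {G : E3 →L[ℝ] E3} {ξ : E3}
    (hlt : -(7175 / 10000) + 1 / 10000 + tailConstSharp 7 <
      ∑ᶠ v ∈ {v : E3 | v ≠ 0 ∧ ‖v‖ ≤ 7 ∧
        v ∈ {v : E3 | ∃ b : Fin 3 → ℤ, v = latPt G hexFrame b ∨ v = latPt G hexFrame b + G (hcpShift + ξ)}}, lennardJones ‖v‖) :
    ¬∃ (M : ℕ) (z : Fin M → E3) (c : Fin M), Admissible M z c ∧
      Set.range z = {x : E3 | dist x (z c) ≤ 133 / 10 ∧ ∃ a : Fin 3 → ℤ,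
        x = z c + latPt G hexFrame a ∨ x = z c + latPt G hexFrame a + G (hcpShift + ξ)} := by
  rintro ⟨M, z, c, hA, hrange⟩
  exact not_admissible_of_centre_removalUnstable (removalUnstableCore_centre_of_latticeSum hA.1 (locHom_hcp_centre hrange) hlt) hA

/-- ★ **(P1)/(P2) PRUNES** (good / bad centre), in the realisability shape; the goodness test may be run on ANY enumeration of the ball
(`goodAtScale_iff_of_range_eq`). [folklore] -/
theorem not_realised_of_centre_good_or_bad {S : E3 → Set E3}
    (h : ∀ (M : ℕ) (z : Fin M → E3) (c : Fin M), Set.range z = S (z c) →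
      GoodAtScale (1 / 20) (3 / 2) z c ∨ ¬GoodAtScale (1 / 8) (3 / 2) z c) :
    ¬∃ (M : ℕ) (z : Fin M → E3) (c : Fin M), Admissible M z c ∧ Set.range z = S (z c) := by
  rintro ⟨M, z, c, hA, hrange⟩
  rcases h M z c hrange with hg | hb
  · exact not_admissible_of_centre_good hg hA
  · exact not_admissible_of_centre_bad hb hA

end Summit.AtomisticToContinuum.Crystallization.Theorems.FrustratedLawDichotomyStrainedPatchHomPrunes

end
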